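import Mathlib.Analysis.SpecialFunctions.Exponential
import Mathlib.Analysis.SpecialFunctions.ExpDeriv
import Mathlib.Analysis.Calculus.MeanValue
import Mathlib.Analysis.Calculus.Deriv.Slope
import Mathlib.Data.Set.Card
import Mathlib.Topology.Order.IntermediateValue
import Literature.Analysis.Approximation.RealExponentialSumZerosProofs

/-!
# `MatrixDescartes` census — real-exponent kit: Descartes-SHARP real exponential sums have only SIMPLE zeros

HONEST FRAMING.  Object-search cell `pub-symmetroid`, item `DoorA26 = PosRootLawAt 2 6 19`
(stmt-ValiantsHypothesis-19979; OPEN, typed, never asserted) and its companion `DoorA34`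
(stmt-ValiantsHypothesis-19980).  This file is a KIT about ONE arbitrary real exponential sum
`u(x) = ∑ ν α_ν e^{s_ν x}` (finitely many terms, real coefficients, real exponents, coincident
exponents allowed); nothing in it mentions pencils.  It is consumed by the companion file
`…CensusRealExponents` (the reduction of the two doors to REAL exponent vectors).  Nothing here
bears on `MatrixDescartes` (stmt-ValiantsHypothesis-18050) or on `VP ≠ VNP`.

CONTENT (elementary; the counting engine is the tree's Literature theorem
`Literature.Analysis.Approximation.Braess1986_VI_1_1_proper_holds` = Laguerre 1898 / Braess 1986
VI §1 Lemma 1.1, «`k` terms ⇒ identically zero or `≤ k − 1` zeros»): `hasDerivAt_expSum`;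
`expSum_zero_or_ncard_le` (Laguerre's bound by the number of DISTINCT exponents — regroup, then
Braess); `expSum_deriv_ne_zero_of_sharp` (**the sharp case is simple**: `u ≢ 0` with
`≥ #distinct exponents − 1` zeros has `u' ≠ 0` at every zero — divide by `e^{cx}` for an occurring
exponent `c`, differentiate, and count Rolle points plus the double zero against Laguerre's bound for
the derivative, which has one distinct exponent fewer); `exists_sign_change_of_hasDerivAt`,
`exists_brackets` (pairwise disjoint sign-change brackets around finitely many simple zeros),
`exists_zero_of_mul_neg` (IVT in bracket form).

[folklore] Rolle's theorem and the intermediate value theorem; Laguerre 1898 / Braess 1986 VI.1.1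
for the count.
-/

-- `Summit.ValiantsHypothesis.ValiantsHypothesis.…` repeats a component by the D-0017 layout
-- (single-conjunct summit), which the `dupNamespace` linter flags; the name is mandated.
set_option linter.dupNamespace false

namespace Summit.ValiantsHypothesis.ValiantsHypothesis.Theorems.LacunarySymmetroidMatrixDescartes.Census.RealExp

open Finset Filter Topology
open scoped BigOperators
open Literature.Analysis.Approximation (Braess1986_VI_1_1_proper_holds)

section ExpSum

variable {ι : Type*} [Fintype ι]

/-- The derivative of the real exponential sum `x ↦ ∑ ν α_ν e^{s_ν x}` is the exponential sum
`x ↦ ∑ ν α_ν s_ν e^{s_ν x}` (same exponents). [folklore] -/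
theorem hasDerivAt_expSum (α s : ι → ℝ) (x : ℝ) :
    HasDerivAt (fun y => ∑ ν, α ν * Real.exp (s ν * y))
      (∑ ν, α ν * (s ν * Real.exp (s ν * x))) x := by
  have h : ∀ ν ∈ (univ : Finset ι),
      HasDerivAt (fun y => α ν * Real.exp (s ν * y)) (α ν * (s ν * Real.exp (s ν * x))) x := by
    intro ν _
    have h1 : HasDerivAt (fun y => s ν * y) (s ν) x := by
      simpa using (hasDerivAt_id x).const_mul (s ν)
    have h2 : HasDerivAt (fun y => Real.exp (s ν * y)) (Real.exp (s ν * x) * s ν) x := h1.exp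
    have h3 := h2.const_mul (α ν)
    simpa [mul_comm] using h3
  simpa using HasDerivAt.fun_sum h

/-- **Laguerre's count in the currency of DISTINCT exponents.**  A real exponential sum
`u(x) = ∑ ν α_ν e^{s_ν x}` (coincident exponents allowed) either vanishes identically on `ℝ`, or
its zero set is finite with at most `#(distinct exponents) − 1` elements.  Proof: regroup the terms
with equal exponent and apply `Braess1986_VI_1_1_proper_holds` to the regrouped sum, which has
`#(distinct exponents)` terms. [folklore] (Laguerre 1898; Braess 1986 VI.1.1) -/
theorem expSum_zero_or_ncard_le [DecidableEq ι] (α s : ι → ℝ) :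
    (∀ x, ∑ ν, α ν * Real.exp (s ν * x) = 0) ∨
      ({x | ∑ ν, α ν * Real.exp (s ν * x) = 0}.Finite ∧
        {x | ∑ ν, α ν * Real.exp (s ν * x) = 0}.ncard ≤ (univ.image s).card - 1) := by
  classical
  set T : Finset ℝ := univ.image s with hT
  set k : ℕ := T.card with hk
  -- enumerate the distinct exponents by `Fin k`
  let e : Fin k ≃ T := (T.equivFin).symm
  let t' : Fin k → ℝ := fun j => ((e j : T) : ℝ)
  let α' : Fin k → ℝ := fun j => ∑ ν ∈ univ.filter (fun ν => s ν = t' j), α ν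
  have hsum : ∀ x, ∑ j, α' j * Real.exp (t' j * x) = ∑ ν, α ν * Real.exp (s ν * x) := by
    intro x
    calc ∑ j, α' j * Real.exp (t' j * x)
        = ∑ j, ∑ ν ∈ univ.filter (fun ν => s ν = t' j), α ν * Real.exp (s ν * x) := by
          refine Finset.sum_congr rfl fun j _ => ?_
          rw [Finset.sum_mul]
          refine Finset.sum_congr rfl fun ν hν => ?_
          rw [(Finset.mem_filter.mp hν).2]
      _ = ∑ c ∈ T, ∑ ν ∈ univ.filter (fun ν => s ν = c), α ν * Real.exp (s ν * x) := by
          rw [← Finset.sum_coe_sort T]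
          exact e.sum_comp (fun c : T => ∑ ν ∈ univ.filter (fun ν => s ν = (c : ℝ)),
            α ν * Real.exp (s ν * x))
      _ = ∑ ν, α ν * Real.exp (s ν * x) :=
          Finset.sum_fiberwise_of_maps_to (fun ν _ => mem_image_of_mem s (mem_univ ν)) _
  have hset : {x | ∑ ν, α ν * Real.exp (s ν * x) = 0} = {x | ∑ j, α' j * Real.exp (t' j * x) = 0} := by
    ext x; simp only [Set.mem_setOf_eq, hsum x]
  rcases Braess1986_VI_1_1_proper_holds k α' t' with h | h
  · left
    intro x
    rw [← hsum x]
    exact h x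
  · right
    rw [hset]
    exact h

/-- **Descartes-SHARP real exponential sums have only simple zeros.**  Let
`u(x) = ∑ ν α_ν e^{s_ν x}` be a real exponential sum, not identically zero, with at least
`#(distinct exponents) − 1` zeros (so, by `expSum_zero_or_ncard_le`, exactly that many).  Then
`u'(x₀) ≠ 0` at every zero `x₀` of `u`.  Proof: pick an occurring exponent `c`; the function
`v = e^{-c x} u` has the same zeros, and `v'` is an exponential sum with one distinct exponent
fewer (the exponent `c` is killed).  If `u'(x₀) = 0` then `v'(x₀) = 0`; together with one Rolle
zero of `v'` strictly inside each gap between consecutive zeros of `u` this gives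
`#zeros(u)` distinct zeros of `v'`, more than Laguerre allows — unless `v' ≡ 0`, i.e. `v` is
constant, i.e. (as `v(x₀) = 0`) `u ≡ 0`. [folklore] -/
theorem expSum_deriv_ne_zero_of_sharp [DecidableEq ι] (α s : ι → ℝ)
    (hne : ∃ x, ∑ ν, α ν * Real.exp (s ν * x) ≠ 0)
    (hcard : (univ.image s).card - 1 ≤ {x | ∑ ν, α ν * Real.exp (s ν * x) = 0}.ncard)
    {x₀ : ℝ} (hx₀ : ∑ ν, α ν * Real.exp (s ν * x₀) = 0) :
    ∑ ν, α ν * (s ν * Real.exp (s ν * x₀)) ≠ 0 := by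
  classical
  intro hder
  obtain ⟨x₁, hx₁⟩ := hne
  -- an occurring exponent `c`
  have hιne : (univ : Finset ι).Nonempty := by
    by_contra h
    rw [Finset.not_nonempty_iff_eq_empty] at h
    apply hx₁
    rw [h]  -- `∑ ν ∈ ∅, _ = 0`
    simp
  obtain ⟨ν₀, -⟩ := hιne
  set c : ℝ := s ν₀ with hc
  set T : Finset ℝ := univ.image s with hT
  set k : ℕ := T.card with hk
  have hcT : c ∈ T := mem_image_of_mem s (mem_univ ν₀)
  have hk1 : 1 ≤ k := Finset.card_pos.mpr ⟨c, hcT⟩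
  -- the zero set of `u` is finite (Laguerre) and contains `x₀`
  set u : ℝ → ℝ := fun x => ∑ ν, α ν * Real.exp (s ν * x) with hu
  have hZ : {x | u x = 0}.Finite ∧ {x | u x = 0}.ncard ≤ k - 1 := by
    rcases expSum_zero_or_ncard_le α s with h | h
    · exact absurd (h x₁) hx₁
    · exact h
  -- `v = e^{-cx} u` and its derivative `w`
  set v : ℝ → ℝ := fun x => ∑ ν, α ν * Real.exp ((s ν - c) * x) with hv
  set w : ℝ → ℝ := fun x => ∑ ν, α ν * ((s ν - c) * Real.exp ((s ν - c) * x)) with hw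
  have hvw : ∀ x, HasDerivAt v (w x) x := fun x => hasDerivAt_expSum α (fun ν => s ν - c) x
  have key : ∀ (ν : ι) (x : ℝ), Real.exp ((s ν - c) * x) = Real.exp (s ν * x) * Real.exp (-(c * x)) := by
    intro ν x
    rw [← Real.exp_add]
    congr 1
    ring
  have huv : ∀ x, v x = u x * Real.exp (-(c * x)) := by
    intro x
    simp only [hv, hu, Finset.sum_mul]
    refine Finset.sum_congr rfl fun ν _ => ?_
    rw [key]
    ring
  have hv_zero_iff : ∀ x, v x = 0 ↔ u x = 0 := by
    intro x
    rw [huv x]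
    simp [Real.exp_ne_zero]
  -- `w(x₀) = 0` because `u(x₀) = u'(x₀) = 0`
  have hwx₀ : w x₀ = 0 := by
    have h1 : w x₀ = (∑ ν, α ν * (s ν * Real.exp (s ν * x₀))) * Real.exp (-(c * x₀))
        - c * (u x₀ * Real.exp (-(c * x₀))) := by
      simp only [hw, hu, Finset.sum_mul, Finset.mul_sum]
      rw [← Finset.sum_sub_distrib]
      refine Finset.sum_congr rfl fun ν _ => ?_
      rw [key]
      ring
    rw [h1, hder]
    have : u x₀ = 0 := hx₀
    rw [this]
    ring
  -- `w` is an exponential sum over the indices with `s ν ≠ c`, whose distinct exponents number `k - 1`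
  let ι' := {ν : ι // s ν ≠ c}
  have hw' : ∀ x, w x = ∑ ν : ι', (α ν.1 * (s ν.1 - c)) * Real.exp ((s ν.1 - c) * x) := by
    intro x
    simp only [hw]
    rw [← Finset.sum_filter_add_sum_filter_not univ (fun ν => s ν ≠ c)]
    have h0 : ∑ ν ∈ univ.filter (fun ν => ¬ s ν ≠ c), α ν * ((s ν - c) * Real.exp ((s ν - c) * x)) = 0 := by
      refine Finset.sum_eq_zero fun ν hν => ?_
      have : s ν = c := by simpa using (Finset.mem_filter.mp hν).2
      rw [this]; ring
    rw [h0, add_zero, Finset.sum_subtype (univ.filter (fun ν => s ν ≠ c)) (p := fun ν => s ν ≠ c)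
      (fun ν => by simp)]
    refine Finset.sum_congr rfl fun ν _ => ?_
    ring
  have hcard' : (univ.image (fun ν : ι' => s ν.1 - c)).card ≤ k - 1 := by
    have hsub : (univ.image (fun ν : ι' => s ν.1 - c)).image (fun y => y + c) ⊆ T.erase c := by
      intro y hy
      simp only [Finset.mem_image, mem_univ, true_and] at hy
      obtain ⟨z, ⟨ν, rfl⟩, rfl⟩ := hy
      rw [Finset.mem_erase]
      refine ⟨?_, ?_⟩
      · have := ν.2; intro h; apply this; linarith
      · have : s ν.1 - c + c = s ν.1 := by ring
        rw [this]; exact mem_image_of_mem s (mem_univ _)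
    have h1 := Finset.card_le_card hsub
    rw [Finset.card_image_of_injective _ (fun a b (h : a + c = b + c) => by linarith),
      Finset.card_erase_of_mem hcT] at h1
    exact h1
  -- sort the zeros of `u`
  obtain ⟨hZfin, hZcard⟩ := hZ
  set Zf : Finset ℝ := hZfin.toFinset with hZf
  set n : ℕ := Zf.card with hn
  have hnZ : {x | u x = 0}.ncard = n := by rw [hn, hZf, Set.ncard_eq_toFinset_card _ hZfin]
  have hx₀Z : x₀ ∈ Zf := by rw [hZf, Set.Finite.mem_toFinset]; exact hx₀
  have hn1 : 1 ≤ n := Finset.card_pos.mpr ⟨x₀, hx₀Z⟩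
  have hnk : k - 1 ≤ n := by rw [← hnZ]; exact hcard
  obtain ⟨N, hN⟩ : ∃ N, n = N + 1 := ⟨n - 1, by omega⟩
  set g := Zf.orderEmbOfFin hN with hg
  have hgmem : ∀ i, g i ∈ Zf := fun i => Finset.orderEmbOfFin_mem Zf hN i
  have hgmono : StrictMono g := (Zf.orderEmbOfFin hN).strictMono
  have hgzero : ∀ i, v (g i) = 0 := by
    intro i
    rw [hv_zero_iff]
    have := hgmem i
    rw [hZf, Set.Finite.mem_toFinset] at this
    exact this
  -- Rolle in each gap
  have hrolle : ∀ i : Fin N, ∃ r ∈ Set.Ioo (g i.castSucc) (g i.succ), w r = 0 := by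
    intro i
    have hlt : g i.castSucc < g i.succ := hgmono (by exact Fin.castSucc_lt_succ)
    exact exists_hasDerivAt_eq_zero hlt
      (fun x _ => (hvw x).continuousAt.continuousWithinAt)
      (by rw [hgzero, hgzero]) (fun x _ => hvw x)
  choose r hrmem hrzero using hrolle
  have hrmono : StrictMono r := by
    intro i j hij
    have h1 : r i < g i.succ := (hrmem i).2
    have h2 : g j.castSucc < r j := (hrmem j).1
    have h3 : g i.succ ≤ g j.castSucc := hgmono.monotone (by
      rw [Fin.le_def, Fin.val_succ, Fin.val_castSucc]; exact hij)
    linarith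
  -- `x₀ = g j₀` is not a Rolle point
  obtain ⟨j₀, hj₀⟩ : ∃ j₀, g j₀ = x₀ := by
    have : x₀ ∈ Set.range g := by
      rw [hg, Finset.range_orderEmbOfFin]; exact hx₀Z
    exact this
  have hx₀r : ∀ i, r i ≠ x₀ := by
    intro i h
    have h1 : g i.castSucc < g j₀ := by rw [hj₀, ← h]; exact (hrmem i).1
    have h2 : g j₀ < g i.succ := by rw [hj₀, ← h]; exact (hrmem i).2
    have h1' := hgmono.lt_iff_lt.mp h1
    have h2' := hgmono.lt_iff_lt.mp h2
    rw [Fin.lt_def, Fin.val_castSucc] at h1'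
    rw [Fin.lt_def, Fin.val_succ] at h2'
    omega
  -- the finset of `N + 1 = n` zeros of `w`
  set R : Finset ℝ := insert x₀ (univ.image r) with hR
  have hRcard : R.card = n := by
    rw [hR, Finset.card_insert_of_notMem, Finset.card_image_of_injective _ hrmono.injective,
      Finset.card_univ, Fintype.card_fin, hN]
    intro h
    simp only [Finset.mem_image, mem_univ, true_and] at h
    obtain ⟨i, hi⟩ := h
    exact hx₀r i hi
  have hRzero : ∀ y ∈ R, w y = 0 := by
    intro y hy
    rw [hR, Finset.mem_insert, Finset.mem_image] at hy
    rcases hy with rfl | ⟨i, -, rfl⟩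
    · exact hwx₀
    · exact hrzero i
  -- Laguerre for `w` (one distinct exponent fewer)
  rcases expSum_zero_or_ncard_le (fun ν : ι' => α ν.1 * (s ν.1 - c)) (fun ν : ι' => s ν.1 - c) with h0 | ⟨hfin, hle⟩
  · -- `w ≡ 0`: `v` is constant, equal to `v x₀ = 0`, so `u ≡ 0`
    have hw0 : ∀ x, w x = 0 := fun x => by rw [hw' x]; exact h0 x
    have hconst : ∀ x, v x = v x₀ := by
      intro x
      refine is_const_of_deriv_eq_zero (fun y => (hvw y).differentiableAt) (fun y => ?_) x x₀
      rw [(hvw y).deriv]; exact hw0 y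
    have : u x₁ = 0 := by
      rw [← hv_zero_iff, hconst x₁, hv_zero_iff]; exact hx₀
    exact hx₁ this
  · have hsubset : (↑R : Set ℝ) ⊆ {x | ∑ ν : ι', (α ν.1 * (s ν.1 - c)) * Real.exp ((s ν.1 - c) * x) = 0} := by
      intro y hy
      rw [Set.mem_setOf_eq, ← hw' y]
      exact hRzero y (Finset.mem_coe.mp hy)
    have h1 := Set.ncard_le_ncard hsubset hfin
    rw [Set.ncard_coe_finset, hRcard] at h1
    have h2 := h1.trans hle
    have h3 : n ≤ k - 1 - 1 := h2.trans (Nat.sub_le_sub_right hcard' 1)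
    omega

end ExpSum

section Brackets

/-- **Sign change at a simple zero.**  If `f` has derivative `f' ≠ 0` at a zero `x₀`, then inside
every window `(x₀ − ε, x₀ + ε)` there are points `a < x₀ < b` with `f a · f b < 0`.
[folklore] -/
theorem exists_sign_change_of_hasDerivAt {f : ℝ → ℝ} {f' x₀ : ℝ} (hf : HasDerivAt f f' x₀)
    (h0 : f x₀ = 0) (hf' : f' ≠ 0) {ε : ℝ} (hε : 0 < ε) :
    ∃ a b : ℝ, x₀ - ε < a ∧ a < x₀ ∧ x₀ < b ∧ b < x₀ + ε ∧ f a * f b < 0 := by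
  have hslope : Tendsto (slope f x₀) (𝓝[≠] x₀) (𝓝 f') := hasDerivAt_iff_tendsto_slope.mp hf
  have hprod : Tendsto (fun y => slope f x₀ y * f') (𝓝[≠] x₀) (𝓝 (f' * f')) :=
    hslope.mul_const f'
  have hpos : 0 < f' * f' := mul_self_pos.mpr hf'
  have hev : ∀ᶠ y in 𝓝[≠] x₀, 0 < slope f x₀ y * f' := (tendsto_order.1 hprod).1 0 hpos
  rw [eventually_nhdsWithin_iff, Metric.eventually_nhds_iff] at hev
  obtain ⟨δ, hδ, hδP⟩ := hev
  set η : ℝ := min δ ε / 2 with hη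
  have hη0 : 0 < η := by rw [hη]; exact half_pos (lt_min hδ hε)
  have hηδ : η < δ := by
    rw [hη]; have := min_le_left δ ε; linarith
  have hηε : η < ε := by
    rw [hη]; have := min_le_right δ ε; linarith
  have hslope_at : ∀ y, y ≠ x₀ → dist y x₀ < δ → 0 < (f y / (y - x₀)) * f' := by
    intro y hy hd
    have := hδP hd hy
    rw [slope_def_field, h0, sub_zero] at this
    exact this
  refine ⟨x₀ - η, x₀ + η, by linarith, by linarith, by linarith, by linarith, ?_⟩
  have ha := hslope_at (x₀ - η) (by linarith) (by
    rw [Real.dist_eq, show x₀ - η - x₀ = -η by ring, abs_neg, abs_of_pos hη0]; exact hηδ)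
  have hb := hslope_at (x₀ + η) (by linarith) (by
    rw [Real.dist_eq, show x₀ + η - x₀ = η by ring, abs_of_pos hη0]; exact hηδ)
  rw [show x₀ - η - x₀ = -η by ring] at ha
  rw [show x₀ + η - x₀ = η by ring] at hb
  -- `f a / (-η) · f' > 0` and `f b / η · f' > 0` force `f a · f b < 0`
  have ha' : f (x₀ - η) * f' < 0 := by
    have h1 : f (x₀ - η) / -η * f' = -(f (x₀ - η) * f') / η := by
      rw [div_neg, neg_mul, neg_div, div_mul_eq_mul_div]
    rw [h1, lt_div_iff₀ hη0, zero_mul] at ha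
    linarith
  have hb' : 0 < f (x₀ + η) * f' := by
    rw [div_mul_eq_mul_div, lt_div_iff₀ hη0, zero_mul] at hb
    exact hb
  have h3 : f (x₀ - η) * f' * (f (x₀ + η) * f') < 0 := mul_neg_of_neg_of_pos ha' hb'
  by_contra hcon
  push Not at hcon
  have h4 : 0 ≤ f (x₀ - η) * f' * (f (x₀ + η) * f') := by
    have : f (x₀ - η) * f' * (f (x₀ + η) * f') = (f (x₀ - η) * f (x₀ + η)) * (f' * f') := by ring
    rw [this]
    exact mul_nonneg hcon hpos.le
  linarith

/-- **Disjoint sign-change brackets around finitely many simple zeros.**  If `f` is differentiable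
with derivative `f'`, and `g : Fin n → ℝ` is a strictly increasing family of zeros of `f` with
`f' (g i) ≠ 0`, then there are brackets `a i < g i < b i` with `f (a i) · f (b i) < 0`, pairwise
disjoint and ordered (`b i < a j` for `i < j`). [folklore] -/
theorem exists_brackets {f f' : ℝ → ℝ} (hf : ∀ x, HasDerivAt f (f' x) x) {n : ℕ} {g : Fin n → ℝ}
    (hg : StrictMono g) (hzero : ∀ i, f (g i) = 0) (hsimple : ∀ i, f' (g i) ≠ 0) :
    ∃ a b : Fin n → ℝ, (∀ i, a i < g i ∧ g i < b i) ∧ (∀ i j, i < j → b i < a j) ∧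
      ∀ i, f (a i) * f (b i) < 0 := by
  classical
  -- a common half-gap `ε`
  obtain ⟨ε, hε, hgap⟩ : ∃ ε : ℝ, 0 < ε ∧ ∀ i j : Fin n, i < j → 2 * ε ≤ g j - g i := by
    set P : Finset (Fin n × Fin n) := univ.filter (fun p => p.1 < p.2) with hP
    by_cases hPe : P.Nonempty
    · set D : Finset ℝ := P.image (fun p => g p.2 - g p.1) with hD
      have hDne : D.Nonempty := hPe.image _
      set m := D.min' hDne with hm
      have hmpos : 0 < m := by
        have hmem := D.min'_mem hDne
        rw [← hm, hD, Finset.mem_image] at hmem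
        obtain ⟨p, hp, hpm⟩ := hmem
        rw [hP, Finset.mem_filter] at hp
        rw [← hpm]
        exact sub_pos.mpr (hg hp.2)
      refine ⟨m / 2, by positivity, fun i j hij => ?_⟩
      have hmem : g j - g i ∈ D := by
        rw [hD, Finset.mem_image]
        exact ⟨(i, j), by rw [hP, Finset.mem_filter]; exact ⟨mem_univ _, hij⟩, rfl⟩
      have := D.min'_le _ hmem
      linarith
    · refine ⟨1, one_pos, fun i j hij => ?_⟩
      exact absurd ⟨(i, j), by rw [hP, Finset.mem_filter]; exact ⟨mem_univ _, hij⟩⟩ hPe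
  have hbr : ∀ i, ∃ a b : ℝ, g i - ε < a ∧ a < g i ∧ g i < b ∧ b < g i + ε ∧ f a * f b < 0 :=
    fun i => exists_sign_change_of_hasDerivAt (hf (g i)) (hzero i) (hsimple i) hε
  choose a b hal hag hgb hbr hsign using hbr
  refine ⟨a, b, fun i => ⟨hag i, hgb i⟩, fun i j hij => ?_, hsign⟩
  have := hgap i j hij
  have h1 := hbr i
  have h2 := hal j
  linarith

/-- **Intermediate value theorem, bracket form.**  A function continuous on `[a, b]` with
`f a · f b < 0` vanishes somewhere in `(a, b)`. [folklore] -/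
theorem exists_zero_of_mul_neg {f : ℝ → ℝ} {a b : ℝ} (hab : a < b) (hf : ContinuousOn f (Set.Icc a b))
    (hs : f a * f b < 0) : ∃ z ∈ Set.Ioo a b, f z = 0 := by
  rcases lt_or_gt_of_ne (show f a ≠ 0 from fun h => by rw [h, zero_mul] at hs; exact lt_irrefl 0 hs)
    with ha | ha
  · -- `f a < 0 < f b`
    have hb : 0 < f b := by
      by_contra h; push Not at h
      have : 0 ≤ f a * f b := mul_nonneg_of_nonpos_of_nonpos ha.le h
      linarith
    obtain ⟨z, hz, hz0⟩ := intermediate_value_Ioo hab.le hf ⟨ha, hb⟩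
    exact ⟨z, hz, hz0⟩
  · have hb : f b < 0 := by
      by_contra h; push Not at h
      have : 0 ≤ f a * f b := mul_nonneg ha.le h
      linarith
    obtain ⟨z, hz, hz0⟩ := intermediate_value_Ioo' hab.le hf ⟨hb, ha⟩
    exact ⟨z, hz, hz0⟩

end Brackets

end Summit.ValiantsHypothesis.ValiantsHypothesis.Theorems.LacunarySymmetroidMatrixDescartes.Census.RealExp
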